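import Summits.QuantumFields.Balaban3D.Proofs.Run3StepCumulant
import Summits.QuantumFields.Balaban3D.Proofs.SeriesAC

/-!
# `Summit.QuantumFields.Balaban3D.Proofs.LeavesCumAC` — the series step leaves C3 `Cumulant58`, C4 `CumulantLower`, B21 `PprT_le` AT THE AC
# TOWER's pieces `SeriesAC.TowerBaseAC.seriesPiecesAC B 𝔖 Cp k` — seat p5's `Run3StepCumulant` twinned over `TowerBaseAC` (uncapped masses,
# `AvgAC` averaging) — lane `pub-balaban3d`, seat alpha-1 (definition request `defn-AlphaInputsT3AC` of route `UnitScaleTilt`; feed `Thm2AC`)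

Statements about the expansion data `𝔖` (the fluctuation integral of (58), the (3.24) inputs, G3D-02, (25)) read through the step pieces;
proofs are seat p5's verbatim with `seriesPieces` ↦ `seriesPiecesAC` (the callees `cumulant58_series_shape`, `cumulantLower_series_shape`,
`pprT_le_torus` are generic over `StepPieces`).  [folklore] bookkeeping; nothing of [Balaban1985UV3] newly asserted.
-/

noncomputable section

open scoped BigOperators Nat
open MeasureTheory Metric Finset
open Literature.MathematicalPhysics.QuantumFieldTheory.Balaban1983to89
open Literature.MathematicalPhysics.QuantumFieldTheory.Balaban1983to89.B10SectAGathering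
open Literature.MathematicalPhysics.QuantumFieldTheory.Balaban1983to89.B10Eq24Cumulant (chiMeasure truncExp)
open Literature.MathematicalPhysics.QuantumFieldTheory.Balaban1983to89.B12TreeDecay (kappa₀ K₀)
open Literature.MathematicalPhysics.QuantumFieldTheory.Balaban1983to89.TreeLengthTorus (tsys tcubeSys TPt)
open Literature.MathematicalPhysics.QuantumFieldTheory.Balaban1985CMP102.Setting (Scales)
open Literature.MathematicalPhysics.QuantumFieldTheory.Balaban1985CMP102.Binders (GraphTerms GraphRep23AsCited)
open Summit.QuantumFields.Balaban3D.Carriers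
open Summit.QuantumFields.Balaban3D.Proofs.ScalesArithmetic (gk_pos gk_le_one largeLoc_le_normRem)
open Summit.QuantumFields.Balaban3D.Proofs.TowerAC
open Summit.QuantumFields.Balaban3D.Proofs.SeriesAC

namespace Summit.QuantumFields.Balaban3D.Proofs.LeavesCumAC

variable {L : ℕ} {S : Scales L} {G : Type} [GaugeGroup G] [MeasurableSpace G] [HaarData G]
  {V : Type} [NormedAddCommGroup V] [NormedSpace ℂ V] {Nc : ℕ → ℕ} [∀ k, NeZero (Nc k)]

/-- **C3 `cumulant58` AT THE CONCRETE PIECES `seriesPieces B 𝔖 C k`.**  DEFINED (rfl): `logFl`, `PprU`, the activity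
family `act`.  (α) END hypotheses: the (3.24) inputs `h324a` (small-field volume of the box), `h324b` (re-expansion of the
printed cumulants `cum`; 0 if `cum := truncExp …`), `h324c` (cumulant remainder) [§F F1]; the graph binder G3D-02 `hG`
for a graph carrier `Gt h` identified with `act` (`hact`); (25) for `act` (`h25`, a THEOREM from G3D-01 + (28) via p6
`bound25_real_of_chart`).  CARR/ARITH: measurability of the box and `μ(box) ≠ 0`, `𝒱` a.e.-measurable and bounded on
the box, `#(blocks ∖ Ωblk h) ≤ |Z_k|(h)`, `N³·…·e^{−Rret} ≤ C₁·rem`, `s^κ'·vol ≤ rem`, signs.  Conclusion: the LQB leaf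
`Cumulant58 (seriesPieces B 𝔖 C k) (C·K₀(32,6)) (0 + C₁ + (Ca + Cb + Cc))`.
[cite: Balaban1985UV3, (24) p.262 + (58)–(59) p.270] -/
theorem cumulant58_seriesAC (B : TowerBaseAC S G) (𝔖 : ∀ k, StepSeries S G V (Nc k) k) (Cp : ∀ k, PiecesParams S k) (k : ℕ)
    [DecidableEq (tsys 3 (𝔖 k).Nblk).Dom] [IsProbabilityMeasure (𝔖 k).μ] {κ C : ℝ}
    (hκ : kappa₀ (4 * 2 ^ 3) (2 * 3) + 1 ≤ κ)
    (Gt : Hist S.P (k + 1) → GraphTerms (tsys 3 (𝔖 k).Nblk) (GaugeField S.P (k + 1) G)) {C₂₃ c M₁ δ₀ : ℝ}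
    (hact : ∀ h X U, (Gt h).activities.act X U = (𝔖 k).act h X U)
    (hboxm : ∀ h, MeasurableSet ((𝔖 k).box h)) (hbox : ∀ h, (𝔖 k).μ ((𝔖 k).box h) ≠ 0)
    (hVm : ∀ h U, AEMeasurable ((𝔖 k).𝒱 h U) (𝔖 k).μ) {Bv : ℝ}
    (hVB : ∀ h U, ∀ ω ∈ (𝔖 k).box h, |(𝔖 k).𝒱 h U ω| ≤ Bv)
    (cum : Hist S.P (k + 1) → GaugeField S.P (k + 1) G → ℕ → ℝ) {nbar : ℕ} {Ca Cb Cc C₁ s κ' vol : ℝ}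
    (h324a : ∀ h (U : GaugeField S.P (k + 1) G), |Real.log ((𝔖 k).μ.real ((𝔖 k).box h))| ≤ Ca * s ^ κ' * vol)
    (h324b : ∀ h U, |∑ n ∈ Finset.Icc 1 nbar, (cum h U n - truncExp ((𝔖 k).𝒱 h U)
        (chiMeasure (𝔖 k).μ (((𝔖 k).box h).indicator fun _ => (1 : ℝ))) n) / (n ! : ℝ)| ≤ Cb * s ^ κ' * vol)
    (h324c : ∀ h U, ∀ t ∈ Set.Icc (0 : ℝ) 1, |iteratedDeriv (nbar + 1) (ProbabilityTheory.cgf ((𝔖 k).𝒱 h U)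
        (chiMeasure (𝔖 k).μ (((𝔖 k).box h).indicator fun _ => (1 : ℝ)))) t| ≤ Cc * ((nbar + 1)! : ℝ) * s ^ κ' * vol)
    (hCabc : 0 ≤ Ca + Cb + Cc) (hrem : s ^ κ' * vol ≤ (Cp k).rem)
    (hCg : 0 ≤ C * (B.withSeriesAC 𝔖 Cp).tower3.toTowerRun.g k) (hR : 0 ≤ B.Rret k)
    (hG : ∀ h, GraphRep23AsCited (Gt h) (fun U => ∑ n ∈ Finset.Icc 1 nbar, cum h U n / (n ! : ℝ)) C₂₃ c M₁ δ₀)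
    (h25 : ∀ h, B10.Bound25Printed
      ⟨(tsys 3 (𝔖 k).Nblk).Dom, GaugeField S.P (k + 1) G, (tsys 3 (𝔖 k).Nblk).dj, (𝔖 k).act h⟩
        ((B.withSeriesAC 𝔖 Cp).tower3.toTowerRun.g k) κ C)
    (hZ : ∀ h, (((Finset.univ : Finset (tcubeSys 3 (𝔖 k).Nblk).Cube) \ ΩblkOf (P := S.P) B.M₁ B.Rcol (Nc k) h).card : ℝ)
      ≤ (B.seriesPiecesAC 𝔖 Cp k).Zvol h)
    (hlarge : (C * (B.withSeriesAC 𝔖 Cp).tower3.toTowerRun.g k * K₀ (4 * 2 ^ 3) (2 * 3) * ((𝔖 k).Nblk : ℝ) ^ 3)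
      * Real.exp (-B.Rret k) ≤ C₁ * (Cp k).rem) :
    Cumulant58 (B.seriesPiecesAC 𝔖 Cp k) (C * K₀ (4 * 2 ^ 3) (2 * 3)) (0 + C₁ + (Ca + Cb + Cc)) :=
  cumulant58_series_shape (𝔖 k).Nblk (B.seriesPiecesAC 𝔖 Cp k) hκ Gt (𝔖 k).act hact (𝔖 k).μ (𝔖 k).box hboxm hbox
    (𝔖 k).𝒱 hVm hVB (fun _ _ => rfl) cum h324a h324b h324c hCabc hrem hCg (fun h => ΩblkOf (P := S.P) B.M₁ B.Rcol (Nc k) h) hR hG h25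
    (fun _ _ => rfl) hZ hlarge

/-- **C4 `cumulantLower` AT THE CONCRETE PIECES** — same data, lower direction at the trivial history.
[cite: Balaban1985UV3, (37) p.265 + p.272 + (59) p.270] -/
theorem cumulantLower_seriesAC (B : TowerBaseAC S G) (𝔖 : ∀ k, StepSeries S G V (Nc k) k) (Cp : ∀ k, PiecesParams S k) (k : ℕ)
    [DecidableEq (tsys 3 (𝔖 k).Nblk).Dom] [IsProbabilityMeasure (𝔖 k).μ] {κ C : ℝ}
    (hκ : kappa₀ (4 * 2 ^ 3) (2 * 3) + 1 ≤ κ)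
    (Gt : Hist S.P (k + 1) → GraphTerms (tsys 3 (𝔖 k).Nblk) (GaugeField S.P (k + 1) G)) {C₂₃ c M₁ δ₀ : ℝ}
    (hact : ∀ h X U, (Gt h).activities.act X U = (𝔖 k).act h X U)
    (hboxm : ∀ h, MeasurableSet ((𝔖 k).box h)) (hbox : ∀ h, (𝔖 k).μ ((𝔖 k).box h) ≠ 0)
    (hVm : ∀ h U, AEMeasurable ((𝔖 k).𝒱 h U) (𝔖 k).μ) {Bv : ℝ}
    (hVB : ∀ h U, ∀ ω ∈ (𝔖 k).box h, |(𝔖 k).𝒱 h U ω| ≤ Bv)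
    (cum : Hist S.P (k + 1) → GaugeField S.P (k + 1) G → ℕ → ℝ) {nbar : ℕ} {Ca Cb Cc C₁ s κ' vol : ℝ}
    (h324a : ∀ h (U : GaugeField S.P (k + 1) G), |Real.log ((𝔖 k).μ.real ((𝔖 k).box h))| ≤ Ca * s ^ κ' * vol)
    (h324b : ∀ h U, |∑ n ∈ Finset.Icc 1 nbar, (cum h U n - truncExp ((𝔖 k).𝒱 h U)
        (chiMeasure (𝔖 k).μ (((𝔖 k).box h).indicator fun _ => (1 : ℝ))) n) / (n ! : ℝ)| ≤ Cb * s ^ κ' * vol)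
    (h324c : ∀ h U, ∀ t ∈ Set.Icc (0 : ℝ) 1, |iteratedDeriv (nbar + 1) (ProbabilityTheory.cgf ((𝔖 k).𝒱 h U)
        (chiMeasure (𝔖 k).μ (((𝔖 k).box h).indicator fun _ => (1 : ℝ)))) t| ≤ Cc * ((nbar + 1)! : ℝ) * s ^ κ' * vol)
    (hCabc : 0 ≤ Ca + Cb + Cc) (hrem : s ^ κ' * vol ≤ (Cp k).rem)
    (hCg : 0 ≤ C * (B.withSeriesAC 𝔖 Cp).tower3.toTowerRun.g k) (hR : 0 ≤ B.Rret k)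
    (hG : ∀ h, GraphRep23AsCited (Gt h) (fun U => ∑ n ∈ Finset.Icc 1 nbar, cum h U n / (n ! : ℝ)) C₂₃ c M₁ δ₀)
    (h25 : ∀ h, B10.Bound25Printed
      ⟨(tsys 3 (𝔖 k).Nblk).Dom, GaugeField S.P (k + 1) G, (tsys 3 (𝔖 k).Nblk).dj, (𝔖 k).act h⟩
        ((B.withSeriesAC 𝔖 Cp).tower3.toTowerRun.g k) κ C)
    (hZ : ∀ h, (((Finset.univ : Finset (tcubeSys 3 (𝔖 k).Nblk).Cube) \ ΩblkOf (P := S.P) B.M₁ B.Rcol (Nc k) h).card : ℝ)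
      ≤ (B.seriesPiecesAC 𝔖 Cp k).Zvol h)
    (hlarge : (C * (B.withSeriesAC 𝔖 Cp).tower3.toTowerRun.g k * K₀ (4 * 2 ^ 3) (2 * 3) * ((𝔖 k).Nblk : ℝ) ^ 3)
      * Real.exp (-B.Rret k) ≤ C₁ * (Cp k).rem) :
    CumulantLower (B.seriesPiecesAC 𝔖 Cp k) (0 + C₁ + (Ca + Cb + Cc)) :=
  cumulantLower_series_shape (𝔖 k).Nblk (B.seriesPiecesAC 𝔖 Cp k) hκ Gt (𝔖 k).act hact (𝔖 k).μ (𝔖 k).box hboxm hbox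
    (𝔖 k).𝒱 hVm hVB (fun _ _ => rfl) cum h324a h324b h324c hCabc hrem hCg (fun h => ΩblkOf (P := S.P) B.M₁ B.Rcol (Nc k) h) hR hG h25
    (fun _ _ => rfl) hZ hlarge

/-- **B21 `PprT_le` AT THE CONCRETE PIECES**: `PprT := Σ_X Re Ψ_X(0)` (p1 `StepSeries.PprT`, the U = 1 vacuum activities
of (62)); with (25) for the activities at the chart origin (`h25`, from G3D-01's bound `M X` at 0), `κ ≥ κ₀(32,6)`,
`0 ≤ C`, `0 ≤ g_k ≤ 1` and `Nblk³ ≤ |T₁^{(k)}|` (p3 `blocks_div_cube_le_sites`):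
`|PprT| ≤ (C·K₀(32,6))·|T₁^{(k)}|`. [cite: Balaban1985UV3, (62) p.271 + p.273] -/
theorem pprT_le_seriesAC (B : TowerBaseAC S G) (𝔖 : ∀ k, StepSeries S G V (Nc k) k) (Cp : ∀ k, PiecesParams S k) (k : ℕ)
    [DecidableEq (tsys 3 (𝔖 k).Nblk).Dom] {κ C : ℝ} (hκ : kappa₀ (4 * 2 ^ 3) (2 * 3) ≤ κ)
    (U₁ : GaugeField S.P (k + 1) G) (hC : 0 ≤ C) (hg : 0 ≤ (B.withSeriesAC 𝔖 Cp).tower3.toTowerRun.g k)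
    (hg1 : (B.withSeriesAC 𝔖 Cp).tower3.toTowerRun.g k ≤ 1)
    (h25 : B10.Bound25Printed
      ⟨(tsys 3 (𝔖 k).Nblk).Dom, GaugeField S.P (k + 1) G, (tsys 3 (𝔖 k).Nblk).dj, fun X _ => ((𝔖 k).Ψ X 0).re⟩
        ((B.withSeriesAC 𝔖 Cp).tower3.toTowerRun.g k) κ C)
    (hblocks : (((𝔖 k).Nblk : ℝ) ^ 3) ≤ (B.withSeriesAC 𝔖 Cp).tower3.toTowerRun.sites k) :
    |(B.seriesPiecesAC 𝔖 Cp k).PprT| ≤ (C * K₀ (4 * 2 ^ 3) (2 * 3)) * (B.withSeriesAC 𝔖 Cp).tower3.toTowerRun.sites k :=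
  pprT_le_torus (𝔖 k).Nblk (B.seriesPiecesAC 𝔖 Cp k) hκ (fun X _ => ((𝔖 k).Ψ X 0).re) U₁ hC hg hg1 h25 rfl hblocks

/-- **C3 with the printed cumulants DEFINED as the truncated expectations of the box-restricted law** (ruling R-324:
`cum h U n := ⟨𝒱ⁿ⟩ᵀ` of `χ·dμ^{(k)}`, so the re-expansion leaf (b) of (3.24) is `0` and drops out): (α) END hypotheses
reduce to the (3.24) inputs (a) `h324a` and (c) `h324c`, the graph binder G3D-02 (about these cumulants) and (25).
[cite: Balaban1985UV3, (24) p.262 + (58)–(59) p.270; Balaban1982Higgs1, (3.24) p.616] -/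
theorem cumulant58_series_selfAC (B : TowerBaseAC S G) (𝔖 : ∀ k, StepSeries S G V (Nc k) k) (Cp : ∀ k, PiecesParams S k) (k : ℕ)
    [DecidableEq (tsys 3 (𝔖 k).Nblk).Dom] [IsProbabilityMeasure (𝔖 k).μ] {κ C : ℝ}
    (hκ : kappa₀ (4 * 2 ^ 3) (2 * 3) + 1 ≤ κ)
    (Gt : Hist S.P (k + 1) → GraphTerms (tsys 3 (𝔖 k).Nblk) (GaugeField S.P (k + 1) G)) {C₂₃ c M₁ δ₀ : ℝ}
    (hact : ∀ h X U, (Gt h).activities.act X U = (𝔖 k).act h X U)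
    (hboxm : ∀ h, MeasurableSet ((𝔖 k).box h)) (hbox : ∀ h, (𝔖 k).μ ((𝔖 k).box h) ≠ 0)
    (hVm : ∀ h U, AEMeasurable ((𝔖 k).𝒱 h U) (𝔖 k).μ) {Bv : ℝ}
    (hVB : ∀ h U, ∀ ω ∈ (𝔖 k).box h, |(𝔖 k).𝒱 h U ω| ≤ Bv) {nbar : ℕ} {Ca Cc C₁ s κ' vol : ℝ}
    (h324a : ∀ h (U : GaugeField S.P (k + 1) G), |Real.log ((𝔖 k).μ.real ((𝔖 k).box h))| ≤ Ca * s ^ κ' * vol)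
    (h324c : ∀ h U, ∀ t ∈ Set.Icc (0 : ℝ) 1, |iteratedDeriv (nbar + 1) (ProbabilityTheory.cgf ((𝔖 k).𝒱 h U)
        (chiMeasure (𝔖 k).μ (((𝔖 k).box h).indicator fun _ => (1 : ℝ)))) t| ≤ Cc * ((nbar + 1)! : ℝ) * s ^ κ' * vol)
    (hCac : 0 ≤ Ca + Cc) (hrem : s ^ κ' * vol ≤ (Cp k).rem)
    (hCg : 0 ≤ C * (B.withSeriesAC 𝔖 Cp).tower3.toTowerRun.g k) (hR : 0 ≤ B.Rret k)
    (hG : ∀ h, GraphRep23AsCited (Gt h) (fun U => ∑ n ∈ Finset.Icc 1 nbar,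
      truncExp ((𝔖 k).𝒱 h U) (chiMeasure (𝔖 k).μ (((𝔖 k).box h).indicator fun _ => (1 : ℝ))) n / (n ! : ℝ))
      C₂₃ c M₁ δ₀)
    (h25 : ∀ h, B10.Bound25Printed
      ⟨(tsys 3 (𝔖 k).Nblk).Dom, GaugeField S.P (k + 1) G, (tsys 3 (𝔖 k).Nblk).dj, (𝔖 k).act h⟩
        ((B.withSeriesAC 𝔖 Cp).tower3.toTowerRun.g k) κ C)
    (hZ : ∀ h, (((Finset.univ : Finset (tcubeSys 3 (𝔖 k).Nblk).Cube) \ ΩblkOf (P := S.P) B.M₁ B.Rcol (Nc k) h).card : ℝ)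
      ≤ (B.seriesPiecesAC 𝔖 Cp k).Zvol h)
    (hlarge : (C * (B.withSeriesAC 𝔖 Cp).tower3.toTowerRun.g k * K₀ (4 * 2 ^ 3) (2 * 3) * ((𝔖 k).Nblk : ℝ) ^ 3)
      * Real.exp (-B.Rret k) ≤ C₁ * (Cp k).rem) :
    Cumulant58 (B.seriesPiecesAC 𝔖 Cp k) (C * K₀ (4 * 2 ^ 3) (2 * 3)) (0 + C₁ + (Ca + 0 + Cc)) :=
  cumulant58_seriesAC B 𝔖 Cp k hκ Gt hact hboxm hbox hVm hVB
    (fun h U n => truncExp ((𝔖 k).𝒱 h U) (chiMeasure (𝔖 k).μ (((𝔖 k).box h).indicator fun _ => (1 : ℝ))) n)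
    h324a (fun h U => by simp) h324c (by linarith) hrem hCg hR hG h25 hZ hlarge

/-! ## v1.1/v1.3 of the expansion data (p1 `Carriers.StepSeries`/`Series`): the G3D-02 carrier `StepSeries.Gt` and the printed
cumulants `StepSeries.cum := truncExp …` are FIELDS/DEFINITIONS of the data, and `hpast` is p1's `TowerInput.tower3_Zvol_proj` -/

/-- **C3 `cumulant58` AT `seriesPieces`, v1.1 SHAPE**: the graph carrier is the data field `(𝔖 k).Gt` and the cumulants are
the DEFINED `(𝔖 k).cum` (truncated expectations of the box-restricted law), so the (3.24) re-expansion input (b) vanishes and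
G3D-02 (`hG`) / R-ACT (`hact`) speak about the data.  Remaining (α) END hypotheses: (3.24) inputs (a) `h324a`, (c) `h324c`
[§F F1], G3D-02 `hG` + `hact` [F2], (25) for `act` (`h25`, a theorem from G3D-01 + (28) by p6 `bound25_real_of_chart`);
CARR/ARITH as in `cumulant58_seriesAC`. [cite: Balaban1985UV3, (24) p.262 + (58)–(59) p.270; Balaban1982Higgs1, (3.24) p.616] -/
theorem cumulant58_series_v11AC (B : TowerBaseAC S G) (𝔖 : ∀ k, StepSeries S G V (Nc k) k) (Cp : ∀ k, PiecesParams S k) (k : ℕ)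
    [DecidableEq (tsys 3 (𝔖 k).Nblk).Dom] [IsProbabilityMeasure (𝔖 k).μ] {κ C : ℝ}
    (hκ : kappa₀ (4 * 2 ^ 3) (2 * 3) + 1 ≤ κ) {C₂₃ c M₁ δ₀ : ℝ}
    (hact : ∀ h X U, ((𝔖 k).Gt h).activities.act X U = (𝔖 k).act h X U)
    (hboxm : ∀ h, MeasurableSet ((𝔖 k).box h)) (hbox : ∀ h, (𝔖 k).μ ((𝔖 k).box h) ≠ 0)
    (hVm : ∀ h U, AEMeasurable ((𝔖 k).𝒱 h U) (𝔖 k).μ) {Bv : ℝ}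
    (hVB : ∀ h U, ∀ ω ∈ (𝔖 k).box h, |(𝔖 k).𝒱 h U ω| ≤ Bv) {nbar : ℕ} {Ca Cc C₁ s κ' vol : ℝ}
    (h324a : ∀ h (U : GaugeField S.P (k + 1) G), |Real.log ((𝔖 k).μ.real ((𝔖 k).box h))| ≤ Ca * s ^ κ' * vol)
    (h324c : ∀ h U, ∀ t ∈ Set.Icc (0 : ℝ) 1, |iteratedDeriv (nbar + 1) (ProbabilityTheory.cgf ((𝔖 k).𝒱 h U)
        (chiMeasure (𝔖 k).μ (((𝔖 k).box h).indicator fun _ => (1 : ℝ)))) t| ≤ Cc * ((nbar + 1)! : ℝ) * s ^ κ' * vol)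
    (hCac : 0 ≤ Ca + Cc) (hrem : s ^ κ' * vol ≤ (Cp k).rem)
    (hCg : 0 ≤ C * (B.withSeriesAC 𝔖 Cp).tower3.toTowerRun.g k) (hR : 0 ≤ B.Rret k)
    (hG : ∀ h, GraphRep23AsCited ((𝔖 k).Gt h) (fun U => ∑ n ∈ Finset.Icc 1 nbar, (𝔖 k).cum h U n / (n ! : ℝ))
      C₂₃ c M₁ δ₀)
    (h25 : ∀ h, B10.Bound25Printed
      ⟨(tsys 3 (𝔖 k).Nblk).Dom, GaugeField S.P (k + 1) G, (tsys 3 (𝔖 k).Nblk).dj, (𝔖 k).act h⟩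
        ((B.withSeriesAC 𝔖 Cp).tower3.toTowerRun.g k) κ C)
    (hZ : ∀ h, (((Finset.univ : Finset (tcubeSys 3 (𝔖 k).Nblk).Cube) \ ΩblkOf (P := S.P) B.M₁ B.Rcol (Nc k) h).card : ℝ)
      ≤ (B.seriesPiecesAC 𝔖 Cp k).Zvol h)
    (hlarge : (C * (B.withSeriesAC 𝔖 Cp).tower3.toTowerRun.g k * K₀ (4 * 2 ^ 3) (2 * 3) * ((𝔖 k).Nblk : ℝ) ^ 3)
      * Real.exp (-B.Rret k) ≤ C₁ * (Cp k).rem) :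
    Cumulant58 (B.seriesPiecesAC 𝔖 Cp k) (C * K₀ (4 * 2 ^ 3) (2 * 3)) (0 + C₁ + (Ca + 0 + Cc)) :=
  cumulant58_series_selfAC B 𝔖 Cp k hκ (𝔖 k).Gt hact hboxm hbox hVm hVB h324a h324c hCac hrem hCg hR hG h25 hZ hlarge

/-- **C4 `cumulantLower` AT `seriesPieces`, v1.1 SHAPE** (same data; lower direction at the trivial history).
[cite: Balaban1985UV3, (37) p.265 + p.272 + (59) p.270] -/
theorem cumulantLower_series_v11AC (B : TowerBaseAC S G) (𝔖 : ∀ k, StepSeries S G V (Nc k) k) (Cp : ∀ k, PiecesParams S k) (k : ℕ)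
    [DecidableEq (tsys 3 (𝔖 k).Nblk).Dom] [IsProbabilityMeasure (𝔖 k).μ] {κ C : ℝ}
    (hκ : kappa₀ (4 * 2 ^ 3) (2 * 3) + 1 ≤ κ) {C₂₃ c M₁ δ₀ : ℝ}
    (hact : ∀ h X U, ((𝔖 k).Gt h).activities.act X U = (𝔖 k).act h X U)
    (hboxm : ∀ h, MeasurableSet ((𝔖 k).box h)) (hbox : ∀ h, (𝔖 k).μ ((𝔖 k).box h) ≠ 0)
    (hVm : ∀ h U, AEMeasurable ((𝔖 k).𝒱 h U) (𝔖 k).μ) {Bv : ℝ}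
    (hVB : ∀ h U, ∀ ω ∈ (𝔖 k).box h, |(𝔖 k).𝒱 h U ω| ≤ Bv) {nbar : ℕ} {Ca Cc C₁ s κ' vol : ℝ}
    (h324a : ∀ h (U : GaugeField S.P (k + 1) G), |Real.log ((𝔖 k).μ.real ((𝔖 k).box h))| ≤ Ca * s ^ κ' * vol)
    (h324c : ∀ h U, ∀ t ∈ Set.Icc (0 : ℝ) 1, |iteratedDeriv (nbar + 1) (ProbabilityTheory.cgf ((𝔖 k).𝒱 h U)
        (chiMeasure (𝔖 k).μ (((𝔖 k).box h).indicator fun _ => (1 : ℝ)))) t| ≤ Cc * ((nbar + 1)! : ℝ) * s ^ κ' * vol)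
    (hCac : 0 ≤ Ca + Cc) (hrem : s ^ κ' * vol ≤ (Cp k).rem)
    (hCg : 0 ≤ C * (B.withSeriesAC 𝔖 Cp).tower3.toTowerRun.g k) (hR : 0 ≤ B.Rret k)
    (hG : ∀ h, GraphRep23AsCited ((𝔖 k).Gt h) (fun U => ∑ n ∈ Finset.Icc 1 nbar, (𝔖 k).cum h U n / (n ! : ℝ))
      C₂₃ c M₁ δ₀)
    (h25 : ∀ h, B10.Bound25Printed
      ⟨(tsys 3 (𝔖 k).Nblk).Dom, GaugeField S.P (k + 1) G, (tsys 3 (𝔖 k).Nblk).dj, (𝔖 k).act h⟩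
        ((B.withSeriesAC 𝔖 Cp).tower3.toTowerRun.g k) κ C)
    (hZ : ∀ h, (((Finset.univ : Finset (tcubeSys 3 (𝔖 k).Nblk).Cube) \ ΩblkOf (P := S.P) B.M₁ B.Rcol (Nc k) h).card : ℝ)
      ≤ (B.seriesPiecesAC 𝔖 Cp k).Zvol h)
    (hlarge : (C * (B.withSeriesAC 𝔖 Cp).tower3.toTowerRun.g k * K₀ (4 * 2 ^ 3) (2 * 3) * ((𝔖 k).Nblk : ℝ) ^ 3)
      * Real.exp (-B.Rret k) ≤ C₁ * (Cp k).rem) :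
    CumulantLower (B.seriesPiecesAC 𝔖 Cp k) (0 + C₁ + (Ca + 0 + Cc)) :=
  cumulantLower_seriesAC B 𝔖 Cp k hκ (𝔖 k).Gt hact hboxm hbox hVm hVB (𝔖 k).cum h324a (fun h U => by simp [StepSeries.cum])
    h324c (by linarith) hrem hCg hR hG h25 hZ hlarge

/-! ## The ARITHMETIC inputs in the lane's normalised units (seat p3 `ScalesArithmetic`): `rem = (L^k g₀²)^{3+κ₀}|T₁^{(k)}|`,
`Rret = R₁ r(g_k)`, `N³ ≤ |T₁^{(k)}|` ⇒ `hrem`, `hlarge` (p3 `largeLoc_le_normRem`), `hR`, `hCg` DISCHARGED -/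

/-- **C3 `cumulant58` AT `seriesPieces` — STANDARD FORM** (v1.1 data + p3's normalised units): besides the (α) END hypotheses
`h324a`/`h324c` [(3.24)(a)(c), with the smallness unit `(L^kg₀²)^{3+κ₀}·|T₁^{(k)}|`], `hG`+`hact` [G3D-02], `h25` [(25) for `act`]
and the box/potential regularity, only RUN SLOTS remain (the block count `hZ` is DISCHARGED by p1's `card_compl_ΩblkOf_le_ZVol`, R-OMEGA): `k ≤ K`, `0 < κ₀`, `1 ≤ r₀`, `6 + 2κ₀ ≤ R₁`, the
bookings `rem = (L^kg₀²)^{3+κ₀}|T₁^{(k)}|` (`hrem`), `Rret = R₁r(g_k)` (`hRret`), `N³ ≤ |T₁^{(k)}|` (`hblocks`).  Constants OUT: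
`Cz = C·K₀(32,6)`, `C₁ = 0 + C·K₀(32,6)·e^{−R₁} + (Ca + 0 + Cc)`. [cite: Balaban1985UV3, (24) p.262 + (58)–(59) p.270; Balaban1982Higgs1, (3.24) p.616] -/
theorem cumulant58_series_stdAC (B : TowerBaseAC S G) (𝔖 : ∀ k, StepSeries S G V (Nc k) k) (Cp : ∀ k, PiecesParams S k) (k : ℕ)
    [DecidableEq (tsys 3 (𝔖 k).Nblk).Dom] [IsProbabilityMeasure (𝔖 k).μ] {κ C : ℝ}
    (hκ : kappa₀ (4 * 2 ^ 3) (2 * 3) + 1 ≤ κ) (hC : 0 ≤ C) {C₂₃ c M₁ δ₀ : ℝ}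
    (hact : ∀ h X U, ((𝔖 k).Gt h).activities.act X U = (𝔖 k).act h X U)
    (hboxm : ∀ h, MeasurableSet ((𝔖 k).box h)) (hbox : ∀ h, (𝔖 k).μ ((𝔖 k).box h) ≠ 0)
    (hVm : ∀ h U, AEMeasurable ((𝔖 k).𝒱 h U) (𝔖 k).μ) {Bv : ℝ}
    (hVB : ∀ h U, ∀ ω ∈ (𝔖 k).box h, |(𝔖 k).𝒱 h U ω| ≤ Bv) {nbar : ℕ} {Ca Cc : ℝ}
    (h324a : ∀ h (U : GaugeField S.P (k + 1) G), |Real.log ((𝔖 k).μ.real ((𝔖 k).box h))| ≤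
      Ca * ((L : ℝ) ^ k * S.g0sq) ^ (3 + B.κ₀) * S.sites k)
    (h324c : ∀ h U, ∀ t ∈ Set.Icc (0 : ℝ) 1, |iteratedDeriv (nbar + 1) (ProbabilityTheory.cgf ((𝔖 k).𝒱 h U)
        (chiMeasure (𝔖 k).μ (((𝔖 k).box h).indicator fun _ => (1 : ℝ)))) t| ≤
          Cc * ((nbar + 1)! : ℝ) * ((L : ℝ) ^ k * S.g0sq) ^ (3 + B.κ₀) * S.sites k)
    (hCac : 0 ≤ Ca + Cc) (hk : k ≤ S.K) (hκ₀ : 0 < B.κ₀) {r₀ R₁ : ℝ} (hr₀ : 1 ≤ r₀) (hR₁ : 6 + 2 * B.κ₀ ≤ R₁)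
    (hrem : (Cp k).rem = ((L : ℝ) ^ k * S.g0sq) ^ (3 + B.κ₀) * S.sites k)
    (hRret : B.Rret k = R₁ * B10.rFun r₀ (S.gk k))
    (hblocks : ((𝔖 k).Nblk : ℝ) ^ 3 ≤ S.sites k)
    (hG : ∀ h, GraphRep23AsCited ((𝔖 k).Gt h) (fun U => ∑ n ∈ Finset.Icc 1 nbar, (𝔖 k).cum h U n / (n ! : ℝ))
      C₂₃ c M₁ δ₀)
    (h25 : ∀ h, B10.Bound25Printed
      ⟨(tsys 3 (𝔖 k).Nblk).Dom, GaugeField S.P (k + 1) G, (tsys 3 (𝔖 k).Nblk).dj, (𝔖 k).act h⟩ (S.gk k) κ C)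
    : Cumulant58 (B.seriesPiecesAC 𝔖 Cp k) (C * K₀ (4 * 2 ^ 3) (2 * 3))
      (0 + C * K₀ (4 * 2 ^ 3) (2 * 3) * Real.exp (-R₁) + (Ca + 0 + Cc)) := by
  have hZ : ∀ h, (((Finset.univ : Finset (tcubeSys 3 (𝔖 k).Nblk).Cube) \ ΩblkOf (P := S.P) B.M₁ B.Rcol (Nc k) h).card : ℝ)
      ≤ (B.seriesPiecesAC 𝔖 Cp k).Zvol h := fun h => by
    show _ ≤ ((ZVol B.M₁ B.Rcol (k + 1) h k : ℕ) : ℝ)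
    exact_mod_cast card_compl_ΩblkOf_le_ZVol (P := S.P) B.M₁ B.Rcol (Nc k) h
  have hg : 0 < S.gk k := gk_pos S k
  have hg1 : S.gk k ≤ 1 := gk_le_one S S.gK_le_one k hk
  have hK₀ : 0 ≤ K₀ (4 * 2 ^ 3) (2 * 3) := (B12TreeDecay.K₀_pos _ _).le
  have hR : 0 ≤ B.Rret k := by
    rw [hRret]; exact mul_nonneg (by linarith) (VacuumAndBooking.rFun_nonneg r₀ (S.gk k) hg hg1)
  have hlarge : (C * S.gk k * K₀ (4 * 2 ^ 3) (2 * 3) * ((𝔖 k).Nblk : ℝ) ^ 3) * Real.exp (-B.Rret k) ≤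
      (C * K₀ (4 * 2 ^ 3) (2 * 3) * Real.exp (-R₁)) * (Cp k).rem := by
    have h := largeLoc_le_normRem S (r₀ := r₀) (R₁ := R₁) (κ₀ := B.κ₀) (A := C * K₀ (4 * 2 ^ 3) (2 * 3))
      (vol := ((𝔖 k).Nblk : ℝ) ^ 3) k hk hr₀ (by linarith) (by linarith) (mul_nonneg hC hK₀) (by positivity) hblocks
    rw [hRret, hrem, ScalesArithmetic.norm_rem_eq]
    calc C * S.gk k * K₀ (4 * 2 ^ 3) (2 * 3) * ((𝔖 k).Nblk : ℝ) ^ 3 * Real.exp (-(R₁ * B10.rFun r₀ (S.gk k)))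
        = C * K₀ (4 * 2 ^ 3) (2 * 3) * S.gk k * ((𝔖 k).Nblk : ℝ) ^ 3 * Real.exp (-(R₁ * B10.rFun r₀ (S.gk k))) := by
          ring
      _ ≤ C * K₀ (4 * 2 ^ 3) (2 * 3) * Real.exp (-R₁) * ((S.gk k ^ 2) ^ (3 + B.κ₀) * S.sites k) := h
  exact cumulant58_series_v11AC B 𝔖 Cp k hκ hact hboxm hbox hVm hVB h324a h324c hCac (le_of_eq hrem.symm)
    (mul_nonneg hC hg.le) hR hG h25 hZ hlarge

/-- **C4 `cumulantLower` AT `seriesPieces` — STANDARD FORM** (same inputs; `C₁' = C₁`). [cite: Balaban1985UV3, (37) p.265 + p.272 + (59) p.270] -/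
theorem cumulantLower_series_stdAC (B : TowerBaseAC S G) (𝔖 : ∀ k, StepSeries S G V (Nc k) k) (Cp : ∀ k, PiecesParams S k) (k : ℕ)
    [DecidableEq (tsys 3 (𝔖 k).Nblk).Dom] [IsProbabilityMeasure (𝔖 k).μ] {κ C : ℝ}
    (hκ : kappa₀ (4 * 2 ^ 3) (2 * 3) + 1 ≤ κ) (hC : 0 ≤ C) {C₂₃ c M₁ δ₀ : ℝ}
    (hact : ∀ h X U, ((𝔖 k).Gt h).activities.act X U = (𝔖 k).act h X U)
    (hboxm : ∀ h, MeasurableSet ((𝔖 k).box h)) (hbox : ∀ h, (𝔖 k).μ ((𝔖 k).box h) ≠ 0)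
    (hVm : ∀ h U, AEMeasurable ((𝔖 k).𝒱 h U) (𝔖 k).μ) {Bv : ℝ}
    (hVB : ∀ h U, ∀ ω ∈ (𝔖 k).box h, |(𝔖 k).𝒱 h U ω| ≤ Bv) {nbar : ℕ} {Ca Cc : ℝ}
    (h324a : ∀ h (U : GaugeField S.P (k + 1) G), |Real.log ((𝔖 k).μ.real ((𝔖 k).box h))| ≤
      Ca * ((L : ℝ) ^ k * S.g0sq) ^ (3 + B.κ₀) * S.sites k)
    (h324c : ∀ h U, ∀ t ∈ Set.Icc (0 : ℝ) 1, |iteratedDeriv (nbar + 1) (ProbabilityTheory.cgf ((𝔖 k).𝒱 h U)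
        (chiMeasure (𝔖 k).μ (((𝔖 k).box h).indicator fun _ => (1 : ℝ)))) t| ≤
          Cc * ((nbar + 1)! : ℝ) * ((L : ℝ) ^ k * S.g0sq) ^ (3 + B.κ₀) * S.sites k)
    (hCac : 0 ≤ Ca + Cc) (hk : k ≤ S.K) (hκ₀ : 0 < B.κ₀) {r₀ R₁ : ℝ} (hr₀ : 1 ≤ r₀) (hR₁ : 6 + 2 * B.κ₀ ≤ R₁)
    (hrem : (Cp k).rem = ((L : ℝ) ^ k * S.g0sq) ^ (3 + B.κ₀) * S.sites k)
    (hRret : B.Rret k = R₁ * B10.rFun r₀ (S.gk k))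
    (hblocks : ((𝔖 k).Nblk : ℝ) ^ 3 ≤ S.sites k)
    (hG : ∀ h, GraphRep23AsCited ((𝔖 k).Gt h) (fun U => ∑ n ∈ Finset.Icc 1 nbar, (𝔖 k).cum h U n / (n ! : ℝ))
      C₂₃ c M₁ δ₀)
    (h25 : ∀ h, B10.Bound25Printed
      ⟨(tsys 3 (𝔖 k).Nblk).Dom, GaugeField S.P (k + 1) G, (tsys 3 (𝔖 k).Nblk).dj, (𝔖 k).act h⟩ (S.gk k) κ C)
    : CumulantLower (B.seriesPiecesAC 𝔖 Cp k) (0 + C * K₀ (4 * 2 ^ 3) (2 * 3) * Real.exp (-R₁) + (Ca + 0 + Cc)) := by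
  have hZ : ∀ h, (((Finset.univ : Finset (tcubeSys 3 (𝔖 k).Nblk).Cube) \ ΩblkOf (P := S.P) B.M₁ B.Rcol (Nc k) h).card : ℝ)
      ≤ (B.seriesPiecesAC 𝔖 Cp k).Zvol h := fun h => by
    show _ ≤ ((ZVol B.M₁ B.Rcol (k + 1) h k : ℕ) : ℝ)
    exact_mod_cast card_compl_ΩblkOf_le_ZVol (P := S.P) B.M₁ B.Rcol (Nc k) h
  have hg : 0 < S.gk k := gk_pos S k
  have hg1 : S.gk k ≤ 1 := gk_le_one S S.gK_le_one k hk
  have hK₀ : 0 ≤ K₀ (4 * 2 ^ 3) (2 * 3) := (B12TreeDecay.K₀_pos _ _).le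
  have hR : 0 ≤ B.Rret k := by
    rw [hRret]; exact mul_nonneg (by linarith) (VacuumAndBooking.rFun_nonneg r₀ (S.gk k) hg hg1)
  have hlarge : (C * S.gk k * K₀ (4 * 2 ^ 3) (2 * 3) * ((𝔖 k).Nblk : ℝ) ^ 3) * Real.exp (-B.Rret k) ≤
      (C * K₀ (4 * 2 ^ 3) (2 * 3) * Real.exp (-R₁)) * (Cp k).rem := by
    have h := largeLoc_le_normRem S (r₀ := r₀) (R₁ := R₁) (κ₀ := B.κ₀) (A := C * K₀ (4 * 2 ^ 3) (2 * 3))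
      (vol := ((𝔖 k).Nblk : ℝ) ^ 3) k hk hr₀ (by linarith) (by linarith) (mul_nonneg hC hK₀) (by positivity) hblocks
    rw [hRret, hrem, ScalesArithmetic.norm_rem_eq]
    calc C * S.gk k * K₀ (4 * 2 ^ 3) (2 * 3) * ((𝔖 k).Nblk : ℝ) ^ 3 * Real.exp (-(R₁ * B10.rFun r₀ (S.gk k)))
        = C * K₀ (4 * 2 ^ 3) (2 * 3) * S.gk k * ((𝔖 k).Nblk : ℝ) ^ 3 * Real.exp (-(R₁ * B10.rFun r₀ (S.gk k))) := by
          ring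
      _ ≤ C * K₀ (4 * 2 ^ 3) (2 * 3) * Real.exp (-R₁) * ((S.gk k ^ 2) ^ (3 + B.κ₀) * S.sites k) := h
  exact cumulantLower_series_v11AC B 𝔖 Cp k hκ hact hboxm hbox hVm hVB h324a h324c hCac (le_of_eq hrem.symm)
    (mul_nonneg hC hg.le) hR hG h25 hZ hlarge

/-- **B21 `PprT_le` AT `seriesPieces` — STANDARD FORM**: (25) at the chart origin for the vacuum activities (`h25`; from G3D-01),
`κ ≥ κ₀(32,6)`, `0 ≤ C`, run slots `k ≤ K` (so `0 < g_k ≤ 1`) and `N³ ≤ |T₁^{(k)}|` ⇒ `|PprT| ≤ C·K₀(32,6)·|T₁^{(k)}|`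
(`aP = C·K₀(32,6)`). [cite: Balaban1985UV3, (62) p.271 + p.273] -/
theorem pprT_le_series_stdAC (B : TowerBaseAC S G) (𝔖 : ∀ k, StepSeries S G V (Nc k) k) (Cp : ∀ k, PiecesParams S k) (k : ℕ)
    [DecidableEq (tsys 3 (𝔖 k).Nblk).Dom] {κ C : ℝ} (hκ : kappa₀ (4 * 2 ^ 3) (2 * 3) ≤ κ) (hC : 0 ≤ C) (hk : k ≤ S.K)
    (U₁ : GaugeField S.P (k + 1) G)
    (h25 : B10.Bound25Printed
      ⟨(tsys 3 (𝔖 k).Nblk).Dom, GaugeField S.P (k + 1) G, (tsys 3 (𝔖 k).Nblk).dj, fun X _ => ((𝔖 k).Ψ X 0).re⟩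
        (S.gk k) κ C)
    (hblocks : (((𝔖 k).Nblk : ℝ) ^ 3) ≤ S.sites k) :
    |(B.seriesPiecesAC 𝔖 Cp k).PprT| ≤ (C * K₀ (4 * 2 ^ 3) (2 * 3)) * S.sites k :=
  pprT_le_seriesAC B 𝔖 Cp k hκ U₁ hC (gk_pos S k).le (gk_le_one S S.gK_le_one k hk) h25 hblocks


end Summit.QuantumFields.Balaban3D.Proofs.LeavesCumAC

end
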